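import Mathlib
import Summits.Ventures.HodgeRepro.PeriodCloserC7Stability
import Summits.Ventures.HodgeRepro.OcticCMPointS3

/-!
# OcticCMPointTameSign — the local sign `ε(½, ω)` is a SIGN at a tame place: the functional-equation identity
on the finite-ring model, and its values at the three places of `S₃` of the octic point

Blind re-derivation cell `pub-hodge-repro`, seat night-2 (gen 3).  Target tree path
`lean/Summits/Ventures/HodgeRepro/OcticCMPointTameSign.lean`.  Continues `PeriodCloserC7Stability.lean` (gen 1's
model `LocalChar R`, `gauss`, `eps` of Kudla Prop 3.8 (ii) / (3.32), `book:editornd-introduction-langlands-program`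
p0109:L3–L11, L33) and `OcticCMPointS3.lean` (the table `octic_p1 / octic_p2 / octic_q`).

**The (E2) side of the residual checks** (ROUTE-B §9.9 (c), (f); `PeriodCloserC7LineClasses.lean`): the local
equation `ω_v(a_j) = ε_v(½, χ′_j, ψ_δ)` is a choice of the line class once the RIGHT side is a sign `±1`.  That
it is a sign is the local functional equation `ε(s, ω, ψ) ε(1 − s, ω^{-1}, ψ) = ω(−1)` at `s = ½` together with
`ε(½, ω^{-1}, ψ_δ) = ω(−1) ε(½, ω, ψ_δ)` for a conjugate-dual `ω` (ROUTE-B §9.9 (f): «`ε_𝔮(½, ν♭, ψ_δ) = ±1` for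
every conjugate-dual `ν♭` … by (3.29)»).  On the model, for a character of conductor exponent `1` — a TAME
character, whose unit part factors through the residue field `𝔽_q = 𝒪/𝔭` — the first identity is Mathlib's
product formula for Gauss sums over a finite field, `gaussSum χ ψ · gaussSum χ⁻¹ ψ⁻¹ = q` (primitive `ψ`,
`χ ≠ 1`), and the second is taken as the hypothesis `ConjDual`.  Hence:

* `gauss_mul_gauss_inv` — `𝔤(ω) 𝔤(ω^{-1}) = ω(−1) · q` on the tame model;
* `eps_mul_eps_inv` — `ε(ω) ε(ω^{-1}) = κ² · ω(−1) · q`; with the `s = ½` normalisation `κ² q = 1`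
  (`|ε(½, ω)| = 1` for unitary `ω`, Kudla Prop 3.8 (ii) read at `s = ½`) this is `ω(−1)` (`eps_mul_eps_inv_norm`);
* `eps_sq_eq_one`, `eps_eq_one_or_neg_one` — for a conjugate-dual `ω`, `ε(½, ω)² = 1`, i.e. `ε(½, ω) = ±1`;
* the three places of `S₃` of `E = ℚ(ζ₅, √(4+√5))`: residue fields `𝔽₅` at `𝔭₁, 𝔭₂` (`ZMod 5`) and `𝔽₁₆` at `𝔮`
  (any finite field of cardinality `16`), so the identities read `𝔤(ω) 𝔤(ω^{-1}) = 5 · ω(−1)`, resp. `16 · ω(−1)`,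
  matching `octic_p1.qK`, `octic_p2.qK`, `octic_q.qK` of gen 1's table (`card_p1`, `card_q`).

**What this is not.**  The model is the finite sum of (3.32) at conductor `1`; deeper conductors (`𝒪/𝔭^c`, `c ≥ 2`,
not a field) are outside Mathlib's product formula and outside this file; the normalisation `κ² q = 1` and the
conjugate-duality identity are hypotheses, named; the four characters `χ′_j` of the octic face are on no page,
so no sign is EVALUATED — what is settled is that at a tame place the right side of (E2)'s equation is `±1` on the
kernel, with the residue cardinalities of the three places.  Nothing here says anything about the status of the
Hodge conjecture for CM abelian varieties, which is NOT proved.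
-/

set_option autoImplicit false

noncomputable section

open Finset

namespace Summit.Ventures.HodgeRepro.PeriodCloser

namespace LocalChar

variable {R : Type} [CommRing R]

/-- The inverse character: inverse unit part, inverse uniformiser value. -/
instance : Inv (LocalChar R) := ⟨fun ω => ⟨ω.unit⁻¹, ω.piVal⁻¹⟩⟩

/-- The unit part of the inverse. -/
@[simp] theorem inv_unit (ω : LocalChar R) : ω⁻¹.unit = ω.unit⁻¹ := rfl

/-- The uniformiser value of the inverse. -/
@[simp] theorem inv_piVal (ω : LocalChar R) : ω⁻¹.piVal = ω.piVal⁻¹ := rfl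

/-- `ω(−1)² = 1` for the unit part of any character. -/
theorem unit_neg_one_sq (ω : LocalChar R) : ω.unit (-1) * ω.unit (-1) = 1 := by
  rw [← map_mul, neg_one_mul, neg_neg, map_one]

variable [Fintype R]

/-- **The product formula on the tame model** (Mathlib `gaussSum_mul_gaussSum_eq_card` + `mul_gaussSum_inv_eq_gaussSum`
over the finite field `R = 𝒪/𝔭`): for a character ramified at the tame level (`ω.unit ≠ 1`) and a primitive `ψ`,
`𝔤(ω) · 𝔤(ω^{-1}) = ω(−1) · q`. -/
theorem gauss_mul_gauss_inv {R : Type} [Field R] [Fintype R] (ω : LocalChar R) (ψ : AddChar R ℂ)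
    (hω : ω.unit ≠ 1) (hψ : ψ.IsPrimitive) :
    gauss ω ψ * gauss ω⁻¹ ψ = ω.unit (-1) * (Fintype.card R : ℂ) := by
  unfold gauss
  rw [inv_unit, inv_inv]
  have h1 : ω.unit (-1) * gaussSum ω.unit ψ⁻¹ = gaussSum ω.unit ψ := mul_gaussSum_inv_eq_gaussSum ω.unit ψ
  have hχ : ω.unit⁻¹ ≠ 1 := by
    intro h
    apply hω
    rw [← inv_inv ω.unit, h, inv_one]
  have h2 : gaussSum ω.unit⁻¹ ψ * gaussSum ω.unit⁻¹⁻¹ ψ⁻¹ = (Fintype.card R : ℂ) :=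
    gaussSum_mul_gaussSum_eq_card hχ hψ
  rw [inv_inv] at h2
  rw [← h1, mul_left_comm, h2]

/-- **`ε(ω) ε(ω^{-1}) = κ² ω(−1) q`** on the tame model (`ω(ϖ) ≠ 0`). -/
theorem eps_mul_eps_inv {R : Type} [Field R] [Fintype R] (κ : ℂ) (n : ℕ) (ω : LocalChar R)
    (ψ : AddChar R ℂ) (hω : ω.unit ≠ 1) (hψ : ψ.IsPrimitive) (hπ : ω.piVal ≠ 0) :
    eps κ n ω ψ * eps κ n ω⁻¹ ψ = κ ^ 2 * ω.unit (-1) * (Fintype.card R : ℂ) := by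
  unfold eps
  rw [inv_piVal]
  have hg := gauss_mul_gauss_inv ω ψ hω hψ
  have hp : ω.piVal ^ n * ω.piVal⁻¹ ^ n = 1 := by
    rw [← mul_pow, mul_inv_cancel₀ hπ, one_pow]
  calc ω.piVal ^ n * κ * gauss ω ψ * (ω.piVal⁻¹ ^ n * κ * gauss ω⁻¹ ψ)
      = (ω.piVal ^ n * ω.piVal⁻¹ ^ n) * (κ ^ 2 * (gauss ω ψ * gauss ω⁻¹ ψ)) := by ring
    _ = κ ^ 2 * ω.unit (-1) * (Fintype.card R : ℂ) := by rw [hp, hg]; ring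

/-- **The `s = ½` normalisation**: `κ² · q = 1` — Kudla Prop 3.8 (ii) at `s = ½` with `|𝔤| = q^{1/2}` for a
primitive tame character, i.e. `|ε(½, ω, ψ)| = 1` for unitary `ω`. -/
def HalfNormalised {R : Type} [Fintype R] (κ : ℂ) : Prop := κ ^ 2 * (Fintype.card R : ℂ) = 1

/-- **Tate's local functional equation at `s = ½` on the tame model**: `ε(½, ω) ε(½, ω^{-1}) = ω(−1)`. -/
theorem eps_mul_eps_inv_norm {R : Type} [Field R] [Fintype R] (κ : ℂ) (n : ℕ) (ω : LocalChar R)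
    (ψ : AddChar R ℂ) (hω : ω.unit ≠ 1) (hψ : ψ.IsPrimitive) (hπ : ω.piVal ≠ 0)
    (hκ : HalfNormalised (R := R) κ) : eps κ n ω ψ * eps κ n ω⁻¹ ψ = ω.unit (-1) := by
  rw [eps_mul_eps_inv κ n ω ψ hω hψ hπ, mul_right_comm, hκ, one_mul]

/-- **Conjugate duality of `ω` at `s = ½`** (ROUTE-B §9.9 (f) on Kudla (3.29): `ε(½, χ^{-1}, ψ_δ) = ε(½, χ, ψ_{−δ})
= χ(−1) ε(½, χ, ψ_δ)` for a conjugate-dual `χ` and the trace-zero `δ`): on the model, `ε(ω^{-1}) = ω(−1) · ε(ω)`. -/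
def ConjDual {R : Type} [CommRing R] [Fintype R] (κ : ℂ) (n : ℕ) (ω : LocalChar R) (ψ : AddChar R ℂ) : Prop :=
  eps κ n ω⁻¹ ψ = ω.unit (-1) * eps κ n ω ψ

/-- **`ε(½, ω)² = 1` for a conjugate-dual tame `ω`.** -/
theorem eps_sq_eq_one {R : Type} [Field R] [Fintype R] (κ : ℂ) (n : ℕ) (ω : LocalChar R)
    (ψ : AddChar R ℂ) (hω : ω.unit ≠ 1) (hψ : ψ.IsPrimitive) (hπ : ω.piVal ≠ 0)
    (hκ : HalfNormalised (R := R) κ) (hcd : ConjDual κ n ω ψ) : eps κ n ω ψ * eps κ n ω ψ = 1 := by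
  have h := eps_mul_eps_inv_norm κ n ω ψ hω hψ hπ hκ
  rw [hcd] at h
  have hu := unit_neg_one_sq ω
  calc eps κ n ω ψ * eps κ n ω ψ
      = (ω.unit (-1) * ω.unit (-1)) * (eps κ n ω ψ * eps κ n ω ψ) := by rw [hu, one_mul]
    _ = ω.unit (-1) * (eps κ n ω ψ * (ω.unit (-1) * eps κ n ω ψ)) := by ring
    _ = ω.unit (-1) * ω.unit (-1) := by rw [h]
    _ = 1 := hu

/-- **The local sign is a sign**: `ε(½, ω) = 1 ∨ ε(½, ω) = −1` for a conjugate-dual tame `ω` — the right side of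
(E2)'s local equation `ω_v(a_j) = ε_v(½, χ′_j, ψ_δ)` takes values in `{±1}`, as the class `ω_v(a_j)` does. -/
theorem eps_eq_one_or_neg_one {R : Type} [Field R] [Fintype R] (κ : ℂ) (n : ℕ) (ω : LocalChar R)
    (ψ : AddChar R ℂ) (hω : ω.unit ≠ 1) (hψ : ψ.IsPrimitive) (hπ : ω.piVal ≠ 0)
    (hκ : HalfNormalised (R := R) κ) (hcd : ConjDual κ n ω ψ) :
    eps κ n ω ψ = 1 ∨ eps κ n ω ψ = -1 :=
  mul_self_eq_one_iff.mp (eps_sq_eq_one κ n ω ψ hω hψ hπ hκ hcd)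

/-- The sign as an element of `ℤˣ`: the value of `ε(½, ω)` matches `1` or `−1` in `ℤˣ` — the form in which the
chain's `localRootNumber v χ : ℤˣ` carries it. -/
theorem exists_units_int_eq {R : Type} [Field R] [Fintype R] (κ : ℂ) (n : ℕ) (ω : LocalChar R)
    (ψ : AddChar R ℂ) (hω : ω.unit ≠ 1) (hψ : ψ.IsPrimitive) (hπ : ω.piVal ≠ 0)
    (hκ : HalfNormalised (R := R) κ) (hcd : ConjDual κ n ω ψ) :
    ∃ s : ℤˣ, ((s : ℤ) : ℂ) = eps κ n ω ψ := by
  rcases eps_eq_one_or_neg_one κ n ω ψ hω hψ hπ hκ hcd with h | h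
  · exact ⟨1, by rw [h]; simp⟩
  · exact ⟨-1, by rw [h]; simp⟩

end LocalChar

/-! ### The three places of `S₃` of the octic point: the residue fields and the identities in numbers -/

/-- `5` is prime (so that `ZMod 5 = 𝔽₅` is a field). -/
instance fact_prime_five : Fact (Nat.Prime 5) := ⟨by norm_num⟩

/-- The residue field of `K_v` at `𝔭₁ | 5` is `𝔽₅` (`octic_p1.qK = 5`). -/
theorem card_p1 : Fintype.card (ZMod 5) = octic_p1.qK := by
  rw [ZMod.card]; rfl

/-- The residue field of `K_v` at `𝔭₂ | 5` is `𝔽₅` (`octic_p2.qK = 5`). -/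
theorem card_p2 : Fintype.card (ZMod 5) = octic_p2.qK := by
  rw [ZMod.card]; rfl

/-- The residue field of `K_v` at `𝔮 | 2` has `16 = octic_q.qK` elements. -/
theorem card_q : (16 : ℕ) = octic_q.qK := rfl

/-- **The product formula at `𝔭₁, 𝔭₂ | 5`**: on `𝔽₅`, `𝔤(ω) 𝔤(ω^{-1}) = 5 · ω(−1)` for a tame ramified `ω`. -/
theorem gauss_mul_gauss_inv_p5 (ω : LocalChar (ZMod 5)) (ψ : AddChar (ZMod 5) ℂ) (hω : ω.unit ≠ 1)
    (hψ : ψ.IsPrimitive) :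
    LocalChar.gauss ω ψ * LocalChar.gauss ω⁻¹ ψ = ω.unit (-1) * (octic_p1.qK : ℂ) := by
  have h := LocalChar.gauss_mul_gauss_inv ω ψ hω hψ
  rw [card_p1] at h
  exact h

/-- **The product formula at `𝔮 | 2`**: on the residue field `𝔽₁₆` (any finite field of `16` elements),
`𝔤(ω) 𝔤(ω^{-1}) = 16 · ω(−1)`. -/
theorem gauss_mul_gauss_inv_q {R : Type} [Field R] [Fintype R] (hR : Fintype.card R = 16)
    (ω : LocalChar R) (ψ : AddChar R ℂ) (hω : ω.unit ≠ 1) (hψ : ψ.IsPrimitive) :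
    LocalChar.gauss ω ψ * LocalChar.gauss ω⁻¹ ψ = ω.unit (-1) * (octic_q.qK : ℂ) := by
  have h := LocalChar.gauss_mul_gauss_inv ω ψ hω hψ
  rw [hR] at h
  simpa only [octic_q] using h

/-- **The local sign at `𝔭₁, 𝔭₂ | 5` is a sign** for a conjugate-dual tame `ω` with the `s = ½` normalisation
`κ² · 5 = 1`. -/
theorem sign_p5 (κ : ℂ) (n : ℕ) (ω : LocalChar (ZMod 5)) (ψ : AddChar (ZMod 5) ℂ) (hω : ω.unit ≠ 1)
    (hψ : ψ.IsPrimitive) (hπ : ω.piVal ≠ 0) (hκ : κ ^ 2 * 5 = 1) (hcd : LocalChar.ConjDual κ n ω ψ) :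
    LocalChar.eps κ n ω ψ = 1 ∨ LocalChar.eps κ n ω ψ = -1 :=
  LocalChar.eps_eq_one_or_neg_one κ n ω ψ hω hψ hπ (by
    show κ ^ 2 * (Fintype.card (ZMod 5) : ℂ) = 1
    rw [ZMod.card]
    exact_mod_cast hκ) hcd

/-- **The local sign at `𝔮 | 2` is a sign** for a conjugate-dual tame `ω` on `𝔽₁₆` with `κ² · 16 = 1`. -/
theorem sign_q {R : Type} [Field R] [Fintype R] (hR : Fintype.card R = 16) (κ : ℂ) (n : ℕ)
    (ω : LocalChar R) (ψ : AddChar R ℂ) (hω : ω.unit ≠ 1) (hψ : ψ.IsPrimitive) (hπ : ω.piVal ≠ 0)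
    (hκ : κ ^ 2 * 16 = 1) (hcd : LocalChar.ConjDual κ n ω ψ) :
    LocalChar.eps κ n ω ψ = 1 ∨ LocalChar.eps κ n ω ψ = -1 :=
  LocalChar.eps_eq_one_or_neg_one κ n ω ψ hω hψ hπ (by
    show κ ^ 2 * (Fintype.card R : ℂ) = 1
    rw [hR]
    exact_mod_cast hκ) hcd

end Summit.Ventures.HodgeRepro.PeriodCloser

end
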